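import Summits.AtomisticToContinuum.BoseEinsteinCondensation.Theses.BECRieszReverseHolder
import Literature.MathematicalPhysics.QuantumManyBody.BoseGasThermodynamicLimitRuelle

/-!
# Route `BECRieszReverseHolder` — support item `GroundStateEnergyFinite` (stmt-AtomisticToContinuum-12844)

Closes stmt-AtomisticToContinuum-12844 (exact signature of
`Summit.AtomisticToContinuum.BoseEinsteinCondensation.Theses.BECRieszReverseHolder.GroundStateEnergyFinite`):
for a repulsive finite-range pair potential `v` there is `ρ₀ > 0` such that for every density
`0 < ρ < ρ₀` the Dirichlet ground-state energy `E₀(N, L_N)` in the box of side `L_N = (N/ρ)^{1/3}`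
is finite for all large `N`.

Proof: with `R > 0` a range of `v` (`IsRepulsiveFiniteRange.exists_pos_range`) take
`ρ₀ = 1/(2(1+R)³)`; then `ρ(1+R)³ < 1`, so the tree's Ruelle programme
(`limsup_lt_top_of_small`, [Ruelle1969, §3.5.11]: one particle per unit cell fits) gives
`limsup_N E₀(N, L_N)/N < ∞`, hence eventually `E₀(N, L_N)/N < ∞`
(`Filter.eventually_lt_of_limsup_lt`), and `E₀ = ∞` would force `E₀/N = ∞`
(`ENNReal.top_div_of_ne_top`).
-/

namespace Summit.AtomisticToContinuum.BoseEinsteinCondensation.Theorems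

open Filter
open scoped ENNReal
open Literature.MathematicalPhysics.QuantumManyBody.BoseGas

/-- **`GroundStateEnergyFinite` holds** (stmt-AtomisticToContinuum-12844): for repulsive finite-range
`v` with range `R`, every density `ρ < 1/(2(1+R)³)` has `E₀(N, (N/ρ)^{1/3}) ≠ ∞` for all large `N`.
[cite: Ruelle1969, §3.5.11] via `limsup_lt_top_of_small`. -/
theorem groundStateEnergyFinite_proof :
    Summit.AtomisticToContinuum.BoseEinsteinCondensation.Theses.BECRieszReverseHolder.GroundStateEnergyFinite := by
  intro v hv
  obtain ⟨R, hR, hv0⟩ := hv.exists_pos_range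
  have h3 : (0 : ℝ) < (1 + R) ^ 3 := by positivity
  refine ⟨1 / (2 * (1 + R) ^ 3), by positivity, fun ρ hρ hρlt => ?_⟩
  have hsmall : ρ * (1 + R) ^ 3 < 1 := by
    calc ρ * (1 + R) ^ 3 < 1 / (2 * (1 + R) ^ 3) * (1 + R) ^ 3 :=
          mul_lt_mul_of_pos_right hρlt h3
      _ = 1 / 2 := by field_simp
      _ < 1 := by norm_num
  have hlim : limsup (energyPerParticleDirichlet v ρ) atTop < ⊤ :=
    limsup_lt_top_of_small hv.1 hv0 hR hρ hsmall
  have hev : ∀ᶠ N : ℕ in atTop, energyPerParticleDirichlet v ρ N < ⊤ :=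
    Filter.eventually_lt_of_limsup_lt hlim
  filter_upwards [hev] with N hN htop
  unfold energyPerParticleDirichlet at hN
  rw [htop, ENNReal.top_div_of_ne_top (ENNReal.natCast_ne_top N)] at hN
  exact lt_irrefl _ hN

end Summit.AtomisticToContinuum.BoseEinsteinCondensation.Theorems
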